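import Summits.QuantumFields.YangMills.Theorems.BalabanUVNodesN18AtRateRecord13
import Literature.MathematicalPhysics.QuantumFieldTheory.Balaban1983to89.Node00.HistoryGermReading

/-!
# BalabanUVNodes ∕ node N18 = NE5 — THE JUNCTION AT GERM CARRIERS IN THE CONSUMED FORM: THE END's E1 (`LeafIndex.ne5_of_leaves`) on W1-14's history half of
# record with NODE A's wall DISPLAYED as L04 `DataLipschitz`, L09 PRODUCED from the insertion of record, L05∕L06 from the (1.18) size classes — the companion of
# module 20 (`…N18AtGermCarriers`, W2 form) answering the lens's type note on `hH` at `Hist := W1.GHist` (Track A, DAG node N18 = `T4OutputRate.NE5` :211; cluster K4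
# «SpineRates», item K3⁷ `SpineGivenEndpointR13SepCoPH`; module 20b of seat pub-ymgap-dag-n18-d, strategy s2)

HONEST FRAMING.  Count-neutral kernel bookkeeping (`--supports stmt-QuantumFields-20544 --as helper`), composition BY NAME of landed theorems (THE END's E1
`Spine.NE5.LeafIndex.ne5_of_leaves`, `T4InputCauchyRateData.insertionDampedNat_of_affine ∕ sizeDampedNat_of_scaleBound`, node00-def-W1's W1-14
`Node00/HistoryGermReading` p551984, this seat's module 18).  NE5 is NOT PRINTED and NOT proved; N18 is NOT discharged; the displayed block (L01–L04, L07, L10, the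
smallness clause) is NODE A's ∕ rows NE2–NE3's content; `Tcfg` is a PARAMETER (background face `hTcfg`, table clause `hTsp`); nothing of Bałaban's is asserted.

WHY.  Module 20 (`…N18AtGermCarriers`, filed 2026-08-27) runs THE END's E1′ at the germ carriers with the W2 datum in the FIBRE form: a representation `hrep` of the
output map by activities and a NODE-A majorant `hH` = holomorphy + domination of the activities on an OPEN set of `Op × Hist` around every base point.  The LENS
«transfer» seat's type note (bus [LENS-TRANSFER-G26-0∕1], cards T39∕T40, `LensTransferSketch26`): at `Hist := W1.GHist = lp (fun _ : GermIdx … ↦ ℂ) ∞` such an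
open set contains tables with NON-ANALYTIC rows, along which Bałaban's (2.38) activities — fluctuation integrals controlled by Cauchy bounds on the terms' own
analyticity cells ([II] pp.7–8) — are not even defined; so `hH` at `GHist` is not an instance of [II] Lemma 3.  Lemma 3 gives the SLICE datum (holomorphy +
domination on `V ∩ (univ ×ˢ A)`, `A` a closed ℂ-submodule of analytic-row tables containing the base), and an anchored quasi-retraction onto `A` turns it into the
wall THE END actually CONSUMES: L04 = `StepModel.DataLipschitz` (E1).  Because W1-14's `histStepModel` is PARAMETRIC in `Out` and `Base`, that road needs no
edition of THE END, of W1-14 or of modules 19a–20: this file states the junction in the consumed form — L04 displayed — so that NODE A may supply its wall by the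
slice road (or any other), and produces L09 (`InsertionDampedNat`) from W1-14's four insertion faces.

WHAT.
* §1 `insertionDampedNat_histStepModel` (L09 by construction), ★ `ne5_germ_of_histStepModel_lip` (germ-NE5 at every member from L01–L04, L07, the size classes, the
  table clause, numerals, L10, `ω + Λc < θ′`), ★ `n18At_u3OfRecord₁₃_readingAdm_of_germEnd_lip` (+ `W1.ne5_readingAdm_of_germ` + module 18 §1 + `ne5_mono`).

One finite four-torus programme at fixed `ε`; NOT the continuum limit, NOT OS, NOT a mass gap, NOT Clay.  0 `def`, 0 `sorry`.

Sources: T. Bałaban, CMP **109** (1987) [Balaban1987RG1] (0.24)–(0.25) p. 257, Thm 1 p. 259, (1.18) p. 263; CMP **116** (1988) [Balaban1988RG2Cluster]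
(1.24) p. 7, (1.26) p. 8, (1.33) p. 9, (2.13)–(2.14) pp. 14–15, Lemma 3 (2.38) p. 20.
-/

noncomputable section

open Set Metric
open scoped Matrix.Norms.L2Operator

namespace YMDAG.N18.W1Reading

open Literature.MathematicalPhysics.QuantumFieldTheory.Balaban1983to89
open Literature.MathematicalPhysics.QuantumFieldTheory.Balaban1983to89.T4Continuum
open Literature.MathematicalPhysics.QuantumFieldTheory.Balaban1983to89.T4OutputRate (Carriers Functional NE5 DecayBound Window)
open Literature.MathematicalPhysics.QuantumFieldTheory.Balaban1983to89.T4InputCauchyRateData (StepModel)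
open Literature.MathematicalPhysics.QuantumFieldTheory.Balaban1983to89.Node00 (Stage13Params prependCoupling MatA ιSU)
open Literature.MathematicalPhysics.QuantumFieldTheory.Balaban1983to89.Node00.Sect2 (domCount domSys CPair ofBackgroundC)
open Literature.MathematicalPhysics.QuantumFieldTheory.Balaban1983to89.Node00.W1 (ReadingData LevelPairing LetterInputs ClusterTower pairOfRecord functionalC
  termC GermIdx germCarriers EAgerm EBgerm GHist histStepModel SizeAdm AdmBg)
open Summit.QuantumFields.BalabanUV.T4Continuum.Spine.NE5
open Summit.QuantumFields.YangMills.BalabanUVNodes.N18Knit (ne5_mono)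
open YMDAG.N18.HLayer
open YMDAG.UVSplit

/-! ## §1 THE CONSUMED FORM: germ-NE5 and N18 from the DATA-LIPSCHITZ wall L04 (E1), no `hrep`∕`hH` displayed

LENS TYPE NOTE (ym-lens-transfer g26, bus 2026-08-27 [LENS-TRANSFER-G26-0∕1], rider R5(a)): at `Hist := W1.GHist = lp (fun _ : GermIdx … ↦ ℂ) ∞` the W2 datum
`hH` of §1–§4 asks holomorphy of the activities in ALL `lp∞` table directions around a base point — directions that include NON-ANALYTIC rows, along which
Bałaban's (2.38) activities (fluctuation integrals controlled by Cauchy bounds on the terms' own analyticity cells, [II] pp.7–8) are not defined; so `hH` at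
`GHist` is NOT an instance of [II] Lemma 3 as displayed.  It is inhabitable from Lemma 3 only through the SLICE datum (holomorphy + domination on
`V ∩ (univ ×ˢ A)`, `A` a closed ℂ-submodule of analytic-row tables containing the base) and an anchored quasi-retraction onto `A` (lens cards T39∕T40,
`LensTransferSketch26`) — and what THE END actually CONSUMES is the wall L04 = `StepModel.DataLipschitz` (`LeafIndex.ne5_of_leaves`, E1), which that road
produces.  This section therefore re-states §3∕§4 in the CONSUMED form: L04 DISPLAYED (NODE A's, by whatever road), L09 = `InsertionDampedNat` PRODUCED from
W1-14's four insertion faces (`insertionDampedNat_of_affine ∘ sizeDampedNat_of_scaleBound`), no `hrep`, no `hH`, no activities. -/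

section Lip

variable (F : T4Family) (M N : ℕ) (k : ℕ) (sp : (k j : ℕ) → (domSys (F.P k) M j).Dom → Set (CPair (F.P k) (MatA N)))
variable {Op : Type} [NormedAddCommGroup Op] [NormedSpace ℂ Op]

/-- **L09 BY CONSTRUCTION FOR THE HISTORY HALF OF RECORD**: W1-14's insertion of record is affine, blind above the step, real-homogeneous and obeys the
single-scale norm identity (`W1.insAffine∕insBlind∕insHomog∕insScaleBound_histStepModel`), hence the CONSUMED W3 law `InsertionDampedNat W κ c ω`
(`T4InputCauchyRateData.insertionDampedNat_of_affine ∘ sizeDampedNat_of_scaleBound`, unit size `E₁ := 1`). [cite: Balaban1988RG2Cluster, (1.24) p.7, (1.26) p.8, (1.33) p.9] -/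
theorem insertionDampedNat_histStepModel (Out : ℕ → Op → GHist F M N k sp → GermIdx F M N k sp → ℂ) (opA opB : (ℕ → ℝ) → Unit → ℕ → Op)
    (Base : ℕ → (ℕ → ℝ) → Unit → Set (Op × GHist F M N k sp)) (rOp rHist : ℕ → ℝ) (hrOp : ∀ n, 0 < rOp n) (hrHist : ∀ n, 0 < rHist n)
    {κ c ω : ℝ} (hc : 0 ≤ c) (hω : 0 ≤ ω) (W : Set (ℕ → ℝ)) :
    (histStepModel F M N k sp Out opA opB Base rOp rHist hrOp hrHist κ c ω).InsertionDampedNat W κ c ω :=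
  (histStepModel F M N k sp Out opA opB Base rOp rHist hrOp hrHist κ c ω).insertionDampedNat_of_affine
    (Node00.W1.insAffine_histStepModel F M N k sp Out opA opB Base rOp rHist hrOp hrHist κ c ω W)
    ((histStepModel F M N k sp Out opA opB Base rOp rHist hrOp hrHist κ c ω).sizeDampedNat_of_scaleBound
      (Node00.W1.insAffine_histStepModel F M N k sp Out opA opB Base rOp rHist hrOp hrHist κ c ω W)
      (Node00.W1.insBlind_histStepModel F M N k sp Out opA opB Base rOp rHist hrOp hrHist κ c ω W)
      (Node00.W1.insHomog_histStepModel F M N k sp Out opA opB Base rOp rHist hrOp hrHist κ c ω W)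
      (Node00.W1.insScaleBound_histStepModel F M N k sp Out opA opB Base rOp rHist hrOp hrHist κ c ω W hc hω zero_le_one) one_pos)

/-- ★ **GERM-NE5 AT W1's HISTORY HALF OF RECORD, CONSUMED FORM (E1)** [bookkeeping; `LeafIndex.ne5_of_leaves` BY NAME at the member-indexed models
`Mb b := W1.histStepModel … (Out b) (opA b) (opB b) (Base b) (rOp b) (rHist b) … κ c ω`]: DISPLAYED — L01 ∕ L02 (representation), L03 (base), ★ L04 `DataLipschitz (Window γ′) κ Λ ρ₀`
(NODE A's CONSUMED wall — from [II] Lemma 3 via the analytic-row slice and an anchored quasi-retraction, lens T39∕T40, or any other road), L07 (rows NE2∕NE3), numerals,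
L10, the smallness clause `ω + Λ·c < θ′`, the (1.18) size classes `hszA`∕`hszB` and the table clause `hTsp`; PRODUCED — L05∕L06 (`W1.decayBound_EAgerm∕EBgerm_of_sizeAdm`),
L08 with `δ′ = 0` (`W1.insertionRate_histStepModel`), L09 (`insertionDampedNat_histStepModel`).  No `hrep`, no `hH`, no activities.  Conclusion: `NE5` over
`W1.germCarriers` for `EAgerm (S k) Tcfg` ∕ `EBgerm (S (k+1)) b` at every member `b ∈ ]0, γ′]`, constant `(Λδ + B)(θ′ − ω)∕(θ′ − (ω + Λc))`.  NOT PRINTED; NOT proved.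
[cite: Balaban1988RG2Cluster, (2.13)–(2.14) pp.14–15, Lemma 3 (2.38) p.20; Balaban1987RG1, (1.18) p.263 and Thm 1 p.259] -/
theorem ne5_germ_of_histStepModel_lip (S : (k : ℕ) → ClusterTower (F.P k) (MatA N) M)
    (Tcfg : CPair (F.P (k + 1)) (MatA N) → CPair (F.P k) (MatA N))
    (hTsp : ∀ (X : Node00.W1.Dom (F.P k) M) (ψ : CPair (F.P (k + 1)) (MatA N)),
      ψ ∈ sp (k + 1) (pairOfRecord F M k X).1 (pairOfRecord F M k X).2 → Tcfg ψ ∈ sp k X.1 X.2)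
    (Out : ℝ → ℕ → Op → GHist F M N k sp → GermIdx F M N k sp → ℂ) (opA opB : ℝ → (ℕ → ℝ) → Unit → ℕ → Op)
    (Base : ℝ → ℕ → (ℕ → ℝ) → Unit → Set (Op × GHist F M N k sp)) (rOp rHist : ℝ → ℕ → ℝ) (hrOp : ∀ b n, 0 < rOp b n) (hrHist : ∀ b n, 0 < rHist b n)
    {κ c ω γ' Λ EA₀ E₀ δ θr θ' ρ₀ B : ℝ} {k₀ : ℕ}
    (l01 : ∀ b : ℝ, 0 < b → b ≤ γ' →
      L01 (histStepModel F M N k sp (Out b) (opA b) (opB b) (Base b) (rOp b) (rHist b) (hrOp b) (hrHist b) κ c ω) (EAgerm F M N k sp (S k) Tcfg) (Window γ'))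
    (l02 : ∀ b : ℝ, 0 < b → b ≤ γ' →
      L02 (histStepModel F M N k sp (Out b) (opA b) (opB b) (Base b) (rOp b) (rHist b) (hrOp b) (hrHist b) κ c ω) (EBgerm F M N k sp (S (k + 1)) b) (Window γ'))
    (l03 : ∀ b : ℝ, 0 < b → b ≤ γ' →
      L03 (histStepModel F M N k sp (Out b) (opA b) (opB b) (Base b) (rOp b) (rHist b) (hrOp b) (hrHist b) κ c ω) (EBgerm F M N k sp (S (k + 1)) b) (Window γ'))
    (l04 : ∀ b : ℝ, 0 < b → b ≤ γ' →
      L04 (histStepModel F M N k sp (Out b) (opA b) (opB b) (Base b) (rOp b) (rHist b) (hrOp b) (hrHist b) κ c ω) (Window γ') κ Λ ρ₀)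
    (hszA : ∀ g ∈ Window γ', ∀ K : ℕ, (fun (j : Fin (K + 1)) Y ψ => termC (S k) j Y g ψ) ∈ SizeAdm (sp k) EA₀ κ K)
    (hszB : ∀ b : ℝ, 0 < b → b ≤ γ' → ∀ g ∈ Window γ', ∀ K : ℕ,
      (fun (j : Fin (K + 1)) Y ψ => termC (S (k + 1)) j Y (prependCoupling b g) ψ) ∈ SizeAdm (sp (k + 1)) E₀ κ K)
    (l07 : ∀ b : ℝ, 0 < b → b ≤ γ' →
      L07 (histStepModel F M N k sp (Out b) (opA b) (opB b) (Base b) (rOp b) (rHist b) (hrOp b) (hrHist b) κ c ω) (Window γ') δ θr)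
    (hΛ : 0 ≤ Λ) (hδ : 0 ≤ δ) (hθ : 0 ≤ θr) (hθθ' : θr ≤ θ') (hθ'1 : θ' ≤ 1) (hc : 0 ≤ c) (hω : 0 < ω)
    (l10near : δ * θr ^ k₀ + c * (EA₀ + E₀) / (1 - ω) ≤ ρ₀) (hB : 0 ≤ B) (l10first : ∀ k < k₀, EA₀ + E₀ ≤ B * θr ^ k) (l11 : ω + Λ * c < θ')
    (b : ℝ) (hb : 0 < b) (hbγ : b ≤ γ') :
    NE5 (C := germCarriers F M N k sp) (EAgerm F M N k sp (S k) Tcfg) (EBgerm F M N k sp (S (k + 1)) b) (Window γ') κ θ'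
      ((Λ * (δ + 0) + B) * (θ' - ω) / (θ' - (ω + Λ * c))) := by
  have hδ0 : 0 ≤ δ + 0 := by rw [add_zero]; exact hδ
  have l10near' : (δ + 0) * θr ^ k₀ + c * (EA₀ + E₀) / (1 - ω) ≤ ρ₀ := by rw [add_zero]; exact l10near
  exact ne5_of_leaves (histStepModel F M N k sp (Out b) (opA b) (opB b) (Base b) (rOp b) (rHist b) (hrOp b) (hrHist b) κ c ω) (l01 b hb hbγ) (l02 b hb hbγ)
    (l03 b hb hbγ) (l04 b hb hbγ) (Node00.W1.decayBound_EAgerm_of_sizeAdm (S k) Tcfg hTsp (Window γ') EA₀ κ hszA)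
    (Node00.W1.decayBound_EBgerm_of_sizeAdm (S (k + 1)) b (Window γ') E₀ κ (hszB b hb hbγ)) (l07 b hb hbγ)
    (Node00.W1.insertionRate_histStepModel F M N k sp (Out b) (opA b) (opB b) (Base b) (rOp b) (rHist b) (hrOp b) (hrHist b) κ c ω (Window γ') κ E₀ θr)
    (insertionDampedNat_histStepModel F M N k sp (Out b) (opA b) (opB b) (Base b) (rOp b) (rHist b) (hrOp b) (hrHist b) hc hω.le (Window γ'))
    hΛ hδ0 hθ hθθ' hθ'1 hc hω l10near' hB l10first l11

end Lip

section LevelLip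

variable {N : ℕ} [NeZero N] {F : T4Family} (θ : Stage13Params F N) (k : ℕ)
variable {Op : Type} [NormedAddCommGroup Op] [NormedSpace ℂ Op]

/-- ★ **THE JUNCTION AT GERM CARRIERS IN THE CONSUMED FORM, ONE STAGE-13 TUPLE AND ONE RUN LENGTH** [bookkeeping; §5's `ne5_germ_of_histStepModel_lip` for every
member + W1-14's restriction face `ne5_readingAdm_of_germ` (background face `hTcfg`) + module 18 §1's `Iff.rfl` face + `n18At_mono`]: the germ block with NODE A's wall in
its CONSUMED form L04 (`DataLipschitz`), L09 produced, L05∕L06 from the (1.18) size classes, letters dominating (`θ.γ ≤ γ′`, `li.κ ≤ κ`, `θ′ ≤ li.θ₅`, `C₅ ≤ li.C₅`) ⇒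
`N18At (u3OfRecord₁₃ θ ((ReadingData.ofRecordAdm F θ.τ9.M N S sp gauge hg T₀ hT₀ li).u3Objects θ.γ) k)`.  NOT PRINTED; NOT proved.
[cite: Balaban1987RG1, (1.18) p.263, (0.24)–(0.25) p.257 and Thm 1 p.259; Balaban1988RG2Cluster, (2.13)–(2.14) pp.14–15 and Lemma 3 (2.38) p.20] -/
theorem n18At_u3OfRecord₁₃_readingAdm_of_germEnd_lip (S : (k : ℕ) → ClusterTower (F.P k) (MatA N) θ.τ9.M)
    (sp : (k j : ℕ) → (domSys (F.P k) θ.τ9.M j).Dom → Set (CPair (F.P k) (MatA N)))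
    (gauge : (k : ℕ) → GaugeField (F.P k) 0 (Node00.SU N) → GaugeField (F.P k) 0 (Node00.SU N) → ℝ) (hg : ∀ k U U', 0 ≤ gauge k U U')
    (T₀ : (k : ℕ) → GaugeField (F.P (k + 1)) 0 (Node00.SU N) → GaugeField (F.P k) 0 (Node00.SU N))
    (hT₀ : ∀ (k : ℕ) (U : GaugeField (F.P (k + 1)) 0 (Node00.SU N)),
      (∀ (j : ℕ) (Y : (domSys (F.P (k + 1)) θ.τ9.M j).Dom), ofBackgroundC (ιSU N) U ∈ sp (k + 1) j Y) →
        ∀ (j : ℕ) (X : (domSys (F.P k) θ.τ9.M j).Dom), ofBackgroundC (ιSU N) (T₀ k U) ∈ sp k j X)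
    (li : LetterInputs) (Tcfg : CPair (F.P (k + 1)) (MatA N) → CPair (F.P k) (MatA N))
    (hTcfg : ∀ U : AdmBg F θ.τ9.M N sp (k + 1), Tcfg (ofBackgroundC (ιSU N) U.1) = ofBackgroundC (ιSU N) (T₀ k U.1))
    (hTsp : ∀ (X : Node00.W1.Dom (F.P k) θ.τ9.M) (ψ : CPair (F.P (k + 1)) (MatA N)),
      ψ ∈ sp (k + 1) (pairOfRecord F θ.τ9.M k X).1 (pairOfRecord F θ.τ9.M k X).2 → Tcfg ψ ∈ sp k X.1 X.2)
    (Out : ℝ → ℕ → Op → GHist F θ.τ9.M N k sp → GermIdx F θ.τ9.M N k sp → ℂ) (opA opB : ℝ → (ℕ → ℝ) → Unit → ℕ → Op)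
    (Base : ℝ → ℕ → (ℕ → ℝ) → Unit → Set (Op × GHist F θ.τ9.M N k sp)) (rOp rHist : ℝ → ℕ → ℝ) (hrOp : ∀ b n, 0 < rOp b n)
    (hrHist : ∀ b n, 0 < rHist b n) {κ c ω γ' Λ EA₀ E₀ δ θr θ' ρ₀ B : ℝ} {k₀ : ℕ}
    (l01 : ∀ b : ℝ, 0 < b → b ≤ γ' →
      L01 (histStepModel F θ.τ9.M N k sp (Out b) (opA b) (opB b) (Base b) (rOp b) (rHist b) (hrOp b) (hrHist b) κ c ω)
        (EAgerm F θ.τ9.M N k sp (S k) Tcfg) (Window γ'))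
    (l02 : ∀ b : ℝ, 0 < b → b ≤ γ' →
      L02 (histStepModel F θ.τ9.M N k sp (Out b) (opA b) (opB b) (Base b) (rOp b) (rHist b) (hrOp b) (hrHist b) κ c ω)
        (EBgerm F θ.τ9.M N k sp (S (k + 1)) b) (Window γ'))
    (l03 : ∀ b : ℝ, 0 < b → b ≤ γ' →
      L03 (histStepModel F θ.τ9.M N k sp (Out b) (opA b) (opB b) (Base b) (rOp b) (rHist b) (hrOp b) (hrHist b) κ c ω)
        (EBgerm F θ.τ9.M N k sp (S (k + 1)) b) (Window γ'))
    (l04 : ∀ b : ℝ, 0 < b → b ≤ γ' →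
      L04 (histStepModel F θ.τ9.M N k sp (Out b) (opA b) (opB b) (Base b) (rOp b) (rHist b) (hrOp b) (hrHist b) κ c ω) (Window γ') κ Λ ρ₀)
    (hszA : ∀ g ∈ Window γ', ∀ K : ℕ, (fun (j : Fin (K + 1)) Y ψ => termC (S k) j Y g ψ) ∈ SizeAdm (sp k) EA₀ κ K)
    (hszB : ∀ b : ℝ, 0 < b → b ≤ γ' → ∀ g ∈ Window γ', ∀ K : ℕ,
      (fun (j : Fin (K + 1)) Y ψ => termC (S (k + 1)) j Y (prependCoupling b g) ψ) ∈ SizeAdm (sp (k + 1)) E₀ κ K)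
    (l07 : ∀ b : ℝ, 0 < b → b ≤ γ' →
      L07 (histStepModel F θ.τ9.M N k sp (Out b) (opA b) (opB b) (Base b) (rOp b) (rHist b) (hrOp b) (hrHist b) κ c ω) (Window γ') δ θr)
    (hΛ : 0 ≤ Λ) (hδ : 0 ≤ δ) (hθ : 0 ≤ θr) (hθθ' : θr ≤ θ') (hθ'1 : θ' ≤ 1) (hc : 0 ≤ c) (hω : 0 < ω)
    (l10near : δ * θr ^ k₀ + c * (EA₀ + E₀) / (1 - ω) ≤ ρ₀) (hB : 0 ≤ B) (l10first : ∀ k < k₀, EA₀ + E₀ ≤ B * θr ^ k) (l11 : ω + Λ * c < θ')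
    (hγ : θ.γ ≤ γ') (hℓκ : li.κ ≤ κ) (hℓθ : θ' ≤ li.θ₅) (hℓC : (Λ * (δ + 0) + B) * (θ' - ω) / (θ' - (ω + Λ * c)) ≤ li.C₅) :
    N18At (u3OfRecord₁₃ θ ((ReadingData.ofRecordAdm F θ.τ9.M N S sp gauge hg T₀ hT₀ li).u3Objects θ.γ) k) := by
  rw [n18At_u3OfRecord₁₃_readingData_iff_pairing]
  intro b hb hbγ
  have h5 := ne5_germ_of_histStepModel_lip F θ.τ9.M N k sp S Tcfg hTsp Out opA opB Base rOp rHist hrOp hrHist l01 l02 l03 l04 hszA hszB l07 hΛ hδ hθ hθθ' hθ'1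
    hc hω l10near hB l10first l11 b hb (hbγ.trans hγ)
  have hrec := Node00.W1.ne5_readingAdm_of_germ S gauge hg T₀ hT₀ li θ.γ Tcfg hTcfg b (Window γ') κ θ' _ h5
  have hW : Window θ.γ ⊆ Window γ' := fun g hgW i => ⟨(hgW i).1, (hgW i).2.trans hγ⟩
  -- the constant is non-negative: `θ′ − (ω + Λc) > 0`, `θ′ − ω ≥ 0`, `Λδ + B ≥ 0`
  have hC₅ : 0 ≤ (Λ * (δ + 0) + B) * (θ' - ω) / (θ' - (ω + Λ * c)) := by
    have h1 : 0 < θ' - (ω + Λ * c) := by linarith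
    have h2 : 0 ≤ θ' - ω := by nlinarith [mul_nonneg hΛ hc]
    have h3 : 0 ≤ Λ * (δ + 0) + B := by rw [add_zero]; positivity
    positivity
  exact ne5_mono hrec hW hℓκ (hθ.trans hθθ') hℓθ hC₅ hℓC

end LevelLip

end YMDAG.N18.W1Reading
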